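import Summits.HodgeConjecture.HodgeCM.Automorphic.AdelicUnitaryModel_1

/-! PORT of `HodgeCM/Automorphic/AdelicUnitaryModel.lean` (HodgeCMPerL run 82) — part 2: continuation of `Summits.HodgeConjecture.HodgeCM.Automorphic.AdelicUnitaryModel_1` (split at a top-level declaration boundary by port_pkg.py; scope re-opened below; declarations unchanged). -/

-- port_pkg: scope re-opened for this part (file-level context, then the namespace/section stack open at the cut)
set_option autoImplicit false
noncomputable section
open NumberField IsDedekindDomain TopologicalSpace Filter
open scoped Topology Matrix
namespace HodgeCM
open HodgeCM.Adelic Literature.NumberTheory.Automorphic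
open Literature.AlgebraicGeometry.ShimuraVarieties
namespace Universe

open MeasureTheory HodgeCM.PerL34 HodgeCM.PerL34.Annihilation
open HodgeCM.Prior.Perl34File HodgeCM.Prior.Perl34File.Perl34

variable (U : Universe)

/-- **Theta data over the ADELIC unitary groups**: HANDOVER #4's `LatticeModelThetaData` with the two lattice
models per context no longer DATA but the adelic unitary groups `G_U(𝔸_{L⁺}) ⊃ G_U(L⁺)` of `V.Hm` and
`U(W)(𝔸_{L₀}) ⊃ U(W)(L₀)` of `diag(a₀, a₁)` (§§5–6), granted the [PRINT] compactness criterion `hP`.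
Remaining DATA: `emb`, `cover`, the sign recipe, the Weil theta model of each context over these groups, the
tori and torus carriers, the theta one-forms. -/
structure AdelicModelThetaData (hP : PrintFact_unitaryCompact) where
  /-- degree-two classes of `P_Γ` as `L²` functions on `[G_U]` -/
  emb : ∀ {L : CMField} {ι₁ : L →+* ℂ} {V : HermSpace3 L ι₁} (Γ : Level V),
    U.CohC (U.pms L ι₁ V Γ) 2 →ₗ[ℂ] (V.latticeModel hP).toQuotientModel.H
  /-- the covering `P_{Γ'} → P_Γ` for `Γ' ≤ Γ` -/
  cover : ∀ {L : CMField} {ι₁ : L →+* ℂ} {V : HermSpace3 L ι₁} (Γ Γ' : Level V),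
    Γ'.Γ ≤ Γ.Γ → U.Mor (U.pms L ι₁ V Γ') (U.pms L ι₁ V Γ)
  /-- sign recipe, first half -/
  kappa : ∀ (K L : CMField), (K →+* L) → (L →+* ℂ) → (L →+* ℂ) → (K →+* ℂ)
  /-- sign recipe, second half -/
  frameSign : ∀ (L : CMField), (L →+* ℂ) → (L →+* ℂ) → Bool
  /-- the Weil theta model of the context, over the adelic unitary groups -/
  wm : ∀ {L : CMField} {ι₁ : L →+* ℂ} (V : HermSpace3 L ι₁) (c : SeesawCtx L),
    WeilThetaModel (V.latticeModel hP).toQuotientModel.G (V.latticeModel hP).toQuotientModel.Γ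
      (c.D.latticeModelW hP).toQuotientModel.G (c.D.latticeModelW hP).toQuotientModel.Γ
  /-- `T₁₂(𝔸)` -/
  T12 : ∀ {L : CMField} {ι₁ : L →+* ℂ}, HermSpace3 L ι₁ → SeesawCtx L → Type
  /-- `T₃₄(𝔸)` -/
  T34 : ∀ {L : CMField} {ι₁ : L →+* ℂ}, HermSpace3 L ι₁ → SeesawCtx L → Type
  [instT12₁ : ∀ {L : CMField} {ι₁ : L →+* ℂ} (V : HermSpace3 L ι₁) (c : SeesawCtx L), Group (T12 V c)]
  [instT12₂ : ∀ {L : CMField} {ι₁ : L →+* ℂ} (V : HermSpace3 L ι₁) (c : SeesawCtx L), TopologicalSpace (T12 V c)]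
  [instT12₃ : ∀ {L : CMField} {ι₁ : L →+* ℂ} (V : HermSpace3 L ι₁) (c : SeesawCtx L), T2Space (T12 V c)]
  [instT12₄ : ∀ {L : CMField} {ι₁ : L →+* ℂ} (V : HermSpace3 L ι₁) (c : SeesawCtx L), MeasurableSpace (T12 V c)]
  [instT12₅ : ∀ {L : CMField} {ι₁ : L →+* ℂ} (V : HermSpace3 L ι₁) (c : SeesawCtx L),
    OpensMeasurableSpace (T12 V c)]
  [instT34₁ : ∀ {L : CMField} {ι₁ : L →+* ℂ} (V : HermSpace3 L ι₁) (c : SeesawCtx L), Group (T34 V c)]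
  [instT34₂ : ∀ {L : CMField} {ι₁ : L →+* ℂ} (V : HermSpace3 L ι₁) (c : SeesawCtx L), TopologicalSpace (T34 V c)]
  [instT34₃ : ∀ {L : CMField} {ι₁ : L →+* ℂ} (V : HermSpace3 L ι₁) (c : SeesawCtx L), T2Space (T34 V c)]
  [instT34₄ : ∀ {L : CMField} {ι₁ : L →+* ℂ} (V : HermSpace3 L ι₁) (c : SeesawCtx L), MeasurableSpace (T34 V c)]
  [instT34₅ : ∀ {L : CMField} {ι₁ : L →+* ℂ} (V : HermSpace3 L ι₁) (c : SeesawCtx L),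
    OpensMeasurableSpace (T34 V c)]
  /-- the (12) torus side over the kernel-model core of the Weil theta model -/
  kt12 : ∀ {L : CMField} {ι₁ : L →+* ℂ} (V : HermSpace3 L ι₁) (c : SeesawCtx L),
    KernelTorusCarrier
      (KernelModel.core (V.latticeModel hP).toQuotientModel (c.D.latticeModelW hP).toQuotientModel (wm V c).SK
        (wm V c).omg (wm V c).θ) (T12 V c)
  /-- the (34) torus side over the kernel-model core of the Weil theta model -/
  kt34 : ∀ {L : CMField} {ι₁ : L →+* ℂ} (V : HermSpace3 L ι₁) (c : SeesawCtx L),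
    KernelTorusCarrier
      (KernelModel.core (V.latticeModel hP).toQuotientModel (c.D.latticeModelW hP).toQuotientModel (wm V c).SK
        (wm V c).omg (wm V c).θ) (T34 V c)
  [instν12 : ∀ {L : CMField} {ι₁ : L →+* ℂ} (V : HermSpace3 L ι₁) (c : SeesawCtx L),
    IsFiniteMeasureOnCompacts (kt12 V c).ν]
  [instν34 : ∀ {L : CMField} {ι₁ : L →+* ℂ} (V : HermSpace3 L ι₁) (c : SeesawCtx L),
    IsFiniteMeasureOnCompacts (kt34 V c).ν]
  /-- the theta one-forms of type `Ψ_i` at level `Γ` -/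
  Theta : ∀ {L : CMField} {ι₁ : L →+* ℂ} (V : HermSpace3 L ι₁), SeesawCtx L → Fin 4 → ∀ Γ : Level V,
    Set (U.CohC (U.pms L ι₁ V Γ) 1)

attribute [instance] AdelicModelThetaData.instT12₁ AdelicModelThetaData.instT12₂ AdelicModelThetaData.instT12₃
  AdelicModelThetaData.instT12₄ AdelicModelThetaData.instT12₅ AdelicModelThetaData.instT34₁
  AdelicModelThetaData.instT34₂ AdelicModelThetaData.instT34₃ AdelicModelThetaData.instT34₄
  AdelicModelThetaData.instT34₅ AdelicModelThetaData.instν12 AdelicModelThetaData.instν34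

namespace AdelicModelThetaData

variable {U} {hP : PrintFact_unitaryCompact} (D : U.AdelicModelThetaData hP)

/-- **The lattice-model theta data of an adelic one**: `latU := V.latticeModel hP`, `lat V c := c.D.latticeModelW hP`.
Reducible, for instance search. -/
abbrev toLatticeModelThetaData : U.LatticeModelThetaData where
  latU := fun _ _ V => V.latticeModel hP
  emb := D.emb
  cover := D.cover
  kappa := D.kappa
  frameSign := D.frameSign
  lat := fun _ c => c.D.latticeModelW hP
  wm := D.wm
  T12 := D.T12
  T34 := D.T34
  kt12 := D.kt12
  kt34 := D.kt34
  Theta := D.Theta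

/-- (Ported verbatim from the HodgeCMPerL package; no docstring in the source.) -/
@[simp] theorem toLatticeModelThetaData_latU (L : CMField) (ι₁ : L →+* ℂ) (V : HermSpace3 L ι₁) :
    D.toLatticeModelThetaData.latU L ι₁ V = V.latticeModel hP := rfl

/-- (Ported verbatim from the HodgeCMPerL package; no docstring in the source.) -/
@[simp] theorem toLatticeModelThetaData_lat {L : CMField} {ι₁ : L →+* ℂ} (V : HermSpace3 L ι₁) (c : SeesawCtx L) :
    D.toLatticeModelThetaData.lat V c = c.D.latticeModelW hP := rfl

/-- The core-side model group of the datum is LITERALLY `↥(regimeSubgroup L V.Hm)` (= `G_U(𝔸_{L⁺})` in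
PerL's regime, `HermSpace3.latticeModelEquiv`). -/
theorem latU_G_eq {L : CMField} {ι₁ : L →+* ℂ} (V : HermSpace3 L ι₁) :
    (D.toLatticeModelThetaData.latU L ι₁ V).G = ↥(regimeSubgroup L V.Hm) := rfl

/-- The theta-side model group of the datum is LITERALLY `↥(regimeSubgroup L diag(a₀, a₁))` (= `U(W)(𝔸_{L₀})`
when `W` is anisotropic, `SeesawDatum.latticeModelWEquiv`). -/
theorem lat_G_eq {L : CMField} {ι₁ : L →+* ℂ} (V : HermSpace3 L ι₁) (c : SeesawCtx L) :
    (D.toLatticeModelThetaData.lat V c).G = ↥(regimeSubgroup L (Matrix.diagonal ![c.D.a 0, c.D.a 1])) := rfl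

end AdelicModelThetaData

end Universe

/-! ### END STATE over the adelic unitary groups -/

namespace Assembly

open MeasureTheory HodgeCM.PerL34 HodgeCM.PerL34.Annihilation
open HodgeCM.Prior.Perl34File HodgeCM.Prior.Perl34File.Perl34
open HodgeCM.Universe (AdelicModelThetaData LatticeModelThetaData WeilModelThetaData KernelModelThetaData ThetaModel)

variable (U : Universe)

/-- **Both realisation inputs of part (a) — `RealisationExistsPerL ∧ RealisationExistsFace` — over the ADELIC
UNITARY GROUPS.**  Hypotheses: the model facts `M`; the [PRINT] compactness criterion `hP` (Margulis 1991
I.3.2.1(b) / Borel 1963) for anisotropic unitary groups; the DATA `D` (Weil theta models over `G_U(𝔸) ⊃ G_U(L⁺)`,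
`U(W)(𝔸) ⊃ U(W)(L₀)`, tori, `emb`, `cover`, signs, theta one-forms); per context and torus side the reduced
annihilation datum; the ten theta `Inputs`; Hodge–Riemann for `(2,0)`-forms.  The core-side GROUPS are no longer data. -/
theorem realisationExists_ofAdelicModelData (M : U.ModelAxioms) (hP : PrintFact_unitaryCompact)
    (D : U.AdelicModelThetaData hP)
    (A12 : ∀ {L : CMField} {ι₁ : L →+* ℂ} (V : HermSpace3 L ι₁) (c : SeesawCtx L),
      QuotientTorusDatum (D.toLatticeModelThetaData.lat V c).toQuotientModel.ν
        (D.toLatticeModelThetaData.toWeilModelThetaData.toKernelModelThetaData.kcore V c).toRegCoreCarrier.toRepCoreCarrier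
        (D.kt12 V c).toRegTorusCarrier.toRepTorusCarrier)
    (A34 : ∀ {L : CMField} {ι₁ : L →+* ℂ} (V : HermSpace3 L ι₁) (c : SeesawCtx L),
      QuotientTorusDatum (D.toLatticeModelThetaData.lat V c).toQuotientModel.ν
        (D.toLatticeModelThetaData.toWeilModelThetaData.toKernelModelThetaData.kcore V c).toRegCoreCarrier.toRepCoreCarrier
        (D.kt34 V c).toRegTorusCarrier.toRepTorusCarrier)
    (A : (ThetaModel.ofRegCarrier
      D.toLatticeModelThetaData.toWeilModelThetaData.toKernelModelThetaData.toKernelThetaCarrier.toRegThetaCarrier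
      (D.toLatticeModelThetaData.analyticKM_of_quotientData A12 A34).toAnalytic).Inputs)
    (hHR : U.Fact_hodgeRiemann20) : U.RealisationExistsPerL ∧ U.RealisationExistsFace :=
  realisationExists_ofLatticeModelData U M D.toLatticeModelThetaData A12 A34 A hHR

/-- **PerL over the adelic unitary groups.** -/
theorem perL_ofAdelicModelData (M : U.ModelAxioms) (hP : PrintFact_unitaryCompact)
    (D : U.AdelicModelThetaData hP)
    (A12 : ∀ {L : CMField} {ι₁ : L →+* ℂ} (V : HermSpace3 L ι₁) (c : SeesawCtx L),
      QuotientTorusDatum (D.toLatticeModelThetaData.lat V c).toQuotientModel.ν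
        (D.toLatticeModelThetaData.toWeilModelThetaData.toKernelModelThetaData.kcore V c).toRegCoreCarrier.toRepCoreCarrier
        (D.kt12 V c).toRegTorusCarrier.toRepTorusCarrier)
    (A34 : ∀ {L : CMField} {ι₁ : L →+* ℂ} (V : HermSpace3 L ι₁) (c : SeesawCtx L),
      QuotientTorusDatum (D.toLatticeModelThetaData.lat V c).toQuotientModel.ν
        (D.toLatticeModelThetaData.toWeilModelThetaData.toKernelModelThetaData.kcore V c).toRegCoreCarrier.toRepCoreCarrier
        (D.kt34 V c).toRegTorusCarrier.toRepTorusCarrier)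
    (A : (ThetaModel.ofRegCarrier
      D.toLatticeModelThetaData.toWeilModelThetaData.toKernelModelThetaData.toKernelThetaCarrier.toRegThetaCarrier
      (D.toLatticeModelThetaData.analyticKM_of_quotientData A12 A34).toAnalytic).Inputs)
    (hHR : U.Fact_hodgeRiemann20) : U.PerL :=
  perL_ofLatticeModelData U M D.toLatticeModelThetaData A12 A34 A hHR

/-- **COR-CM, END STATE over the adelic unitary groups.** -/
theorem COR_CM_endState_ofAdelicModelData (M : U.ModelAxioms) (h29 : U.Fact_weightSpan)
    (h30 : U.Fact_weightHodge) (hE : U.Qw8ExtProd) (hD : U.Qw8DualPushPull) (hMi : U.Qw8Milne)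
    (hP : PrintFact_unitaryCompact) (D : U.AdelicModelThetaData hP)
    (A12 : ∀ {L : CMField} {ι₁ : L →+* ℂ} (V : HermSpace3 L ι₁) (c : SeesawCtx L),
      QuotientTorusDatum (D.toLatticeModelThetaData.lat V c).toQuotientModel.ν
        (D.toLatticeModelThetaData.toWeilModelThetaData.toKernelModelThetaData.kcore V c).toRegCoreCarrier.toRepCoreCarrier
        (D.kt12 V c).toRegTorusCarrier.toRepTorusCarrier)
    (A34 : ∀ {L : CMField} {ι₁ : L →+* ℂ} (V : HermSpace3 L ι₁) (c : SeesawCtx L),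
      QuotientTorusDatum (D.toLatticeModelThetaData.lat V c).toQuotientModel.ν
        (D.toLatticeModelThetaData.toWeilModelThetaData.toKernelModelThetaData.kcore V c).toRegCoreCarrier.toRepCoreCarrier
        (D.kt34 V c).toRegTorusCarrier.toRepTorusCarrier)
    (A : (ThetaModel.ofRegCarrier
      D.toLatticeModelThetaData.toWeilModelThetaData.toKernelModelThetaData.toKernelThetaCarrier.toRegThetaCarrier
      (D.toLatticeModelThetaData.analyticKM_of_quotientData A12 A34).toAnalytic).Inputs)
    (hHR : U.Fact_hodgeRiemann20) : U.HC_CM :=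
  COR_CM_endState_ofLatticeModelData U M h29 h30 hE hD hMi D.toLatticeModelThetaData A12 A34 A hHR

end Assembly

end HodgeCM

end
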